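import Literature.NumberTheory.ComplexMultiplication.GaloisSemidihedralModularNormalForms
import Mathlib.Algebra.Group.Subgroup.Finite
import Mathlib.Tactic.IntervalCases
import HarnessLib

/-!
# COSET INTERVALS `⊔_{i<h} αⁱ U` in a group `G = ⟨α⟩·U` (`ord α = 2h`, `⟨α⟩ ∩ U = 1`): a CM set for `α^h`,
# right-`U`-invariant, and of trivial left stabiliser when `U` acts on `⟨α⟩` by multipliers other than `±1`

COR-CM (cell `pub-hodgecm2`), binder seat b04 (gen 23), count-neutral claim CYCLIC-BY-MULTIPLIERS, part II — the
group-theoretic half of part III (`CorCM/GaloisCyclicByMultipliersDegenerate`).  KERNEL ONLY: theorems (Mathlib + part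
VIII-a `CorCM/GaloisSemidihedralModularNormalForms` only); no definition, no named fact, no `sorry`.  `HC_CM` is neither
used nor claimed.

SETTING.  A finite group `G`, `α ∈ G` with `ord α = 2h`, a subgroup `U ≤ G` with `⟨α⟩ ∩ U = 1` and `|G| = 2h·|U|`, so
that every element is uniquely `αˣ w` (`x ∈ ℤ/2h`, `w ∈ U`; §1 `exists_normalForm_sub`, `normalForm_sub_inj`).  The
COSET INTERVAL is `T = {αˣ w : x.val < h, w ∈ U} = ⊔_{i<h} αⁱ U` (§2 `exists_cosetInterval`):
* it is a CM set for `c = α^h` (`cosetInterval_cm`) and RIGHT-`U`-INVARIANT (`cosetInterval_mul_right`: `(αˣ w) u =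
  αˣ (w u)`), hence — part I `GaloisModels.exists_simple_degenerate_of_model_skew` — read by a DEGENERATE CM type as
  soon as `U ≠ 1`;
* if every `w ∈ U` normalises `⟨α⟩`, `w α w⁻¹ = α^{u_w}` (a MULTIPLIER `u_w ∈ (ℤ/2h)ˣ`, `u_w u_{w⁻¹} = 1`, §1
  `mul_eq_one_of_mult`), acts non-trivially for `w ≠ 1` and NEVER as inversion (`u_w ≠ −1`), then `T` has
  TRIVIAL LEFT STABILISER (§3 `cosetInterval_leftStabiliser`): `αʲ` shifts the interval, and `αʲ w` would give the
  affine bijection `i ↦ j + u_w i` of `ℤ/2h` preserving `[0, h)`, under which exactly one `y ∈ [0,h)` has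
  `y + u_w ∉ [0,h)` — but `h−1, h−2` (for `2 ≤ u_w ≤ h`) resp. `0, 1` (for `h < u_w ≤ 2h−2`) are two such `y` (the
  argument of gen 22 part X, with `u²  = 1` replaced by `u u' = 1`);
* under the same hypotheses the only central involution of `G` is `α^h` (§3 `central_involution_eq_pow_sub`).
Part X's double interval is the case `U = ⟨ξ⟩` of order `2`.

## References

* [Shimura1998] G. Shimura, *Abelian Varieties with Complex Multiplication and Modular Functions*, §8.2 Prop. 26
  (primitivity = trivial stabiliser), §18.2 Lemma (i).

Provenance: Literature home (namespace `Literature.NumberTheory.ComplexMultiplication.GaloisCosetInterval`) of the Summits-side `CorCM/GaloisCosetIntervalTypes` (cell `pub-hodgecm2`, COR-CM; all its imports are `Literature/`, Mathlib and the already re-homed `GaloisSemidihedralModularNormalForms`), which `Literature/` may not import; theorems only, no named fact, no definition. Nothing here bears on `HC_CM`. Lane `lit-hodgefound` (Layer A3: CM types, their Kubota ranks and Galois combinatorics), seat p20.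
-/

noncomputable section

namespace Literature.NumberTheory.ComplexMultiplication.GaloisCosetInterval

open Literature.NumberTheory.ComplexMultiplication.GaloisSemidihedral Literature.NumberTheory.ComplexMultiplication.CyclicAsymmetricHalves

open Literature.NumberTheory.ComplexMultiplication.GaloisSemidihedral
open Literature.NumberTheory.ComplexMultiplication.CyclicAsymmetricHalves

/-! ## §1 Normal forms `αˣ w` in `G = ⟨α⟩·U` -/

section Group

variable {G : Type*} [Group G] {α : G} {U : Subgroup G} {h : ℕ}

/-- `αⁿ = α^{(n mod 2h)}` read through `ZMod.val`. [cite: Shimura1998, §18.2 Lemma (i)] -/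
theorem pow_eq_pow_val_natCast [NeZero h] (hord : orderOf α = 2 * h) (n : ℕ) :
    α ^ n = α ^ ((n : ℕ) : ZMod (2 * h)).val := by
  haveI : NeZero (2 * h) := ⟨by have := NeZero.ne h; omega⟩
  rw [ZMod.val_natCast, ← hord, pow_mod_orderOf]

/-- **Uniqueness of the normal form**: `αˣ w = αʸ w'` with `w, w' ∈ U` forces `x = y` and `w = w'` (`⟨α⟩ ∩ U = 1`).
 [cite: Shimura1998, §18.2 Lemma (i)] -/
theorem normalForm_sub_inj [NeZero h] (hord : orderOf α = 2 * h)
    (hAU : ∀ w ∈ U, w ∈ Subgroup.zpowers α → w = 1) {x y : ZMod (2 * h)} {w w' : G} (hw : w ∈ U) (hw' : w' ∈ U)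
    (heq : α ^ x.val * w = α ^ y.val * w') : x = y ∧ w = w' := by
  have h1 : w * w'⁻¹ = (α ^ x.val)⁻¹ * α ^ y.val := by
    rw [eq_inv_mul_iff_mul_eq, ← mul_assoc, heq, mul_inv_cancel_right]
  have hmem : w * w'⁻¹ ∈ Subgroup.zpowers α := by
    rw [h1]
    exact Subgroup.mul_mem _ (Subgroup.inv_mem _ (Subgroup.pow_mem _ (Subgroup.mem_zpowers α) _))
      (Subgroup.pow_mem _ (Subgroup.mem_zpowers α) _)
  have hww : w = w' := mul_inv_eq_one.1 (hAU _ (U.mul_mem hw (U.inv_mem hw')) hmem)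
  subst hww
  exact ⟨(pow_val_inj hord).1 (mul_right_cancel heq), rfl⟩

/-- **Every element is `αˣ w`** (`|G| = 2h·|U|`, `⟨α⟩ ∩ U = 1`). [cite: Shimura1998, §18.2 Lemma (i)] -/
theorem exists_normalForm_sub [Fintype G] [NeZero h] (hord : orderOf α = 2 * h)
    (hAU : ∀ w ∈ U, w ∈ Subgroup.zpowers α → w = 1) (hcard : Fintype.card G = 2 * h * Nat.card U) (g : G) :
    ∃ x : ZMod (2 * h), ∃ w : G, w ∈ U ∧ g = α ^ x.val * w := by
  classical
  haveI : NeZero (2 * h) := ⟨by have := NeZero.ne h; omega⟩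
  let f : ZMod (2 * h) × U → G := fun p => α ^ p.1.val * (p.2 : G)
  have hinj : Function.Injective f := by
    rintro ⟨x, w⟩ ⟨y, w'⟩ hxy
    obtain ⟨hx, hw⟩ := normalForm_sub_inj hord hAU w.2 w'.2 hxy
    exact Prod.ext hx (Subtype.ext hw)
  have hbij : Function.Bijective f := by
    rw [Fintype.bijective_iff_injective_and_card]
    refine ⟨hinj, ?_⟩
    rw [Fintype.card_prod, ZMod.card, hcard, ← Nat.card_eq_fintype_card]
  obtain ⟨⟨x, w⟩, hs⟩ := hbij.2 g
  exact ⟨x, w, w.2, hs.symm⟩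

/-- Products with a multiplier: `(αˣ g)(αʸ w) = α^{x + u y} (g w)` when `g α = α^{u₀} g`. [cite: Shimura1998, §18.2 Lemma (i)] -/
theorem mult_mul_normalForm [NeZero h] (hord : orderOf α = 2 * h) {g : G} {u₀ : ℕ} (hrel : g * α = α ^ u₀ * g)
    (x y : ZMod (2 * h)) (w : G) :
    (α ^ x.val * g) * (α ^ y.val * w) = α ^ (x + (u₀ : ZMod (2 * h)) * y).val * (g * w) := by
  rw [mul_assoc, ← mul_assoc g, xi_mul_pow_val hord hrel, mul_assoc, ← mul_assoc (α ^ x.val), ← pow_val_add hord]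

/-- **The multipliers of `w` and `w⁻¹` are inverse**: `w α = α^{u₀} w`, `w⁻¹ α = α^{u₁} w⁻¹` give `u₀ u₁ = 1` in
`ℤ/2h`. [cite: Shimura1998, §18.2 Lemma (i)] -/
theorem mul_eq_one_of_mult [NeZero h] (hord : orderOf α = 2 * h) {w : G} {u₀ u₁ : ℕ}
    (hrel : w * α = α ^ u₀ * w) (hrel' : w⁻¹ * α = α ^ u₁ * w⁻¹) : (u₀ : ZMod (2 * h)) * u₁ = 1 := by
  haveI : NeZero (2 * h) := ⟨by have := NeZero.ne h; omega⟩
  have h1 : α = α ^ (u₁ * u₀) := by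
    calc α = w⁻¹ * (w * α) := by rw [inv_mul_cancel_left]
      _ = w⁻¹ * α ^ u₀ * w := by rw [hrel, mul_assoc]
      _ = α ^ (u₁ * u₀) * w⁻¹ * w := by rw [xi_mul_pow hrel']
      _ = α ^ (u₁ * u₀) := by rw [inv_mul_cancel_right]
  have h2 : α ^ (1 : ℕ) = α ^ (u₁ * u₀) := by rw [pow_one]; exact h1
  rw [pow_eq_pow_iff_modEq, hord] at h2
  have h3 := (ZMod.natCast_eq_natCast_iff' 1 (u₁ * u₀) (2 * h)).2 h2
  rw [Nat.cast_one, Nat.cast_mul] at h3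
  exact (mul_comm _ _).trans h3.symm

/-! ## §2 The coset interval: existence, CM property, right invariance -/

variable {T : Finset G}

/-- **The coset interval exists**: `αˣ w ∈ T ↔ x.val < h` for `w ∈ U`. [cite: Shimura1998, §18.2 Lemma (i)] -/
theorem exists_cosetInterval [Fintype G] [NeZero h] (hord : orderOf α = 2 * h)
    (hAU : ∀ w ∈ U, w ∈ Subgroup.zpowers α → w = 1) :
    ∃ T : Finset G, ∀ x : ZMod (2 * h), ∀ w ∈ U, α ^ x.val * w ∈ T ↔ x.val < h := by
  classical
  refine ⟨Finset.univ.filter fun g => ∃ x : ZMod (2 * h), ∃ w : G, w ∈ U ∧ x.val < h ∧ g = α ^ x.val * w,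
    fun x w hw => ?_⟩
  simp only [Finset.mem_filter, Finset.mem_univ, true_and]
  constructor
  · rintro ⟨y, w', hw', hy, heq⟩
    rwa [(normalForm_sub_inj hord hAU hw hw' heq).1]
  · exact fun hx => ⟨x, w, hw, hx, rfl⟩

/-- **CM set for `c = α^h`**: `g ∈ T ↔ α^h g ∉ T`. [cite: Shimura1998, §18.2 Lemma (i)] -/
theorem cosetInterval_cm [Fintype G] [NeZero h] (hord : orderOf α = 2 * h)
    (hAU : ∀ w ∈ U, w ∈ Subgroup.zpowers α → w = 1) (hcard : Fintype.card G = 2 * h * Nat.card U)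
    (hT : ∀ x : ZMod (2 * h), ∀ w ∈ U, α ^ x.val * w ∈ T ↔ x.val < h) (g : G) : g ∈ T ↔ α ^ h * g ∉ T := by
  haveI : NeZero (2 * h) := ⟨by have := NeZero.ne h; omega⟩
  have hh : 1 ≤ h := Nat.pos_of_ne_zero (NeZero.ne h)
  have hαh : α ^ h = α ^ ((h : ℕ) : ZMod (2 * h)).val := by rw [val_natCast_of_lt' (show h < 2 * h by omega)]
  obtain ⟨x, w, hw, rfl⟩ := exists_normalForm_sub hord hAU hcard g
  rw [hαh, ← mul_assoc, ← pow_val_add hord, hT x w hw, hT _ w hw, add_comm,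
    val_add_natCast_eq x (show h < 2 * h by omega)]
  have := x.val_lt
  split_ifs <;> omega

/-- **Right `U`-invariance**: `g u ∈ T ↔ g ∈ T` for `u ∈ U` (`(αˣ w) u = αˣ (w u)`). [cite: Shimura1998, §18.2 Lemma (i)] -/
theorem cosetInterval_mul_right [Fintype G] [NeZero h] (hord : orderOf α = 2 * h)
    (hAU : ∀ w ∈ U, w ∈ Subgroup.zpowers α → w = 1) (hcard : Fintype.card G = 2 * h * Nat.card U)
    (hT : ∀ x : ZMod (2 * h), ∀ w ∈ U, α ^ x.val * w ∈ T ↔ x.val < h) {u : G} (hu : u ∈ U) (g : G) :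
    g * u ∈ T ↔ g ∈ T := by
  obtain ⟨x, w, hw, rfl⟩ := exists_normalForm_sub hord hAU hcard g
  rw [mul_assoc, hT x (w * u) (U.mul_mem hw hu), hT x w hw]

/-! ## §3 Multipliers: the affine interval lemma, trivial left stabiliser, the central involution -/

/-- **An affine bijection `i ↦ j + u i` of `ℤ/2h` (`u` a unit, `u ≠ ±1`, `h ≥ 2`) does NOT preserve the interval
`[0, h)`**: under such a bijection exactly one `y ∈ [0,h)` would have `y + u ∉ [0,h)` (the image of `h − 1`), but
`h−1, h−2` (for `2 ≤ u ≤ h`) resp. `0, 1` (for `h < u ≤ 2h−2`) are two such `y`. [cite: Shimura1998, §18.2 Lemma (i)] -/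
theorem not_affine_preserves_interval (h2 : 2 ≤ h) {u u' j : ZMod (2 * h)} (hu : u * u' = 1) (hu1 : u ≠ 1)
    (hu2 : u ≠ -1) : ¬ ∀ i : ZMod (2 * h), (i.val < h ↔ (j + u * i).val < h) := by
  haveI : NeZero h := ⟨by omega⟩
  haveI : NeZero (2 * h) := ⟨by omega⟩
  haveI : Fact (1 < 2 * h) := ⟨by omega⟩
  intro P
  have uniq : ∀ i : ZMod (2 * h), (j + u * i).val < h → ¬ ((j + u * (i + 1)).val < h) → i.val = h - 1 :=
    fun i hy hyu => by
    have hi : i.val < h := (P i).2 hy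
    have hi1 : ¬ ((i + 1).val < h) := fun h' => hyu ((P (i + 1)).1 h')
    have := val_add_natCast_eq i (show 1 < 2 * h by omega)
    rw [Nat.cast_one] at this
    rw [this] at hi1
    split_ifs at hi1 <;> omega
  have pre : ∀ y : ZMod (2 * h), j + u * (u' * (y - j)) = y := fun y => by
    rw [← mul_assoc, hu, one_mul, add_sub_cancel]
  have step : ∀ y : ZMod (2 * h), j + u * (u' * (y - j) + 1) = y + u := fun y => by
    rw [mul_add, mul_one, ← add_assoc, pre]
  have key : ∀ y : ZMod (2 * h), y.val < h → ¬ ((y + u).val < h) → (u' * (y - j)).val = h - 1 :=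
    fun y hy hyu => uniq _ (by rwa [pre]) (by rwa [step])
  have hb := u.val_lt
  have hb1 : u.val ≠ 1 := fun h1 => hu1 (by
    apply ZMod.val_injective; rw [h1, ZMod.val_one])
  have hbm : u.val ≠ 2 * h - 1 := fun h1 => hu2 (by
    apply ZMod.val_injective
    rw [h1, ZMod.neg_val, if_neg (one_ne_zero), ZMod.val_one])
  have hb0 : u.val ≠ 0 := fun h0 => by
    have : u = 0 := (ZMod.val_eq_zero u).1 h0
    rw [this, zero_mul] at hu
    exact zero_ne_one hu
  have hu_cast : u = ((u.val : ℕ) : ZMod (2 * h)) := (ZMod.natCast_zmod_val u).symm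
  rcases Nat.lt_or_ge u.val (h + 1) with hsmall | hlarge
  · -- `2 ≤ u ≤ h`: `y = h - 1` and `y = h - 2`
    have w1 := key ((h - 1 : ℕ) : ZMod (2 * h)) (by rw [val_natCast_of_lt' (by omega)]; omega) (by
      rw [hu_cast, ← Nat.cast_add, val_natCast_of_lt' (show h - 1 + u.val < 2 * h by omega)]; omega)
    have w2 := key ((h - 2 : ℕ) : ZMod (2 * h)) (by rw [val_natCast_of_lt' (by omega)]; omega) (by
      rw [hu_cast, ← Nat.cast_add, val_natCast_of_lt' (show h - 2 + u.val < 2 * h by omega)]; omega)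
    have heq : u' * (((h - 1 : ℕ) : ZMod (2 * h)) - j) = u' * (((h - 2 : ℕ) : ZMod (2 * h)) - j) := by
      apply ZMod.val_injective; rw [w1, w2]
    have heq' : ((h - 1 : ℕ) : ZMod (2 * h)) = ((h - 2 : ℕ) : ZMod (2 * h)) := by
      have := congrArg (fun z => j + u * z) heq
      simp only [pre] at this
      exact this
    have := congrArg ZMod.val heq'
    rw [val_natCast_of_lt' (show h - 1 < 2 * h by omega), val_natCast_of_lt' (show h - 2 < 2 * h by omega)]
      at this
    omega
  · -- `h + 1 ≤ u ≤ 2h - 2`: `y = 0` and `y = 1`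
    have w1 := key ((0 : ℕ) : ZMod (2 * h)) (by rw [val_natCast_of_lt' (by omega)]; omega) (by
      rw [Nat.cast_zero, zero_add]; omega)
    have w2 := key ((1 : ℕ) : ZMod (2 * h)) (by rw [val_natCast_of_lt' (by omega)]; omega) (by
      rw [hu_cast, ← Nat.cast_add, val_natCast_of_lt' (show 1 + u.val < 2 * h by omega)]; omega)
    have heq : u' * (((0 : ℕ) : ZMod (2 * h)) - j) = u' * (((1 : ℕ) : ZMod (2 * h)) - j) := by
      apply ZMod.val_injective; rw [w1, w2]
    have heq' : ((0 : ℕ) : ZMod (2 * h)) = ((1 : ℕ) : ZMod (2 * h)) := by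
      have := congrArg (fun z => j + u * z) heq
      simp only [pre] at this
      exact this
    have := congrArg ZMod.val heq'
    rw [val_natCast_of_lt' (show 0 < 2 * h by omega), val_natCast_of_lt' (show 1 < 2 * h by omega)] at this
    omega

/-- **The multiplier of `w ∈ U` as a unit of `ℤ/2h` different from `±1`**: if `w α = α^{u₀} w`, `U` normalises `⟨α⟩`,
`w ≠ 1` acts non-trivially and `w` does not invert `α`, then `u₀ u₁ = 1` for the multiplier `u₁` of `w⁻¹`, `u₀ ≠ 1`
and `u₀ ≠ −1` in `ℤ/2h`. [cite: Shimura1998, §18.2 Lemma (i)] -/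
theorem multiplier_unit_ne [NeZero h] (hord : orderOf α = 2 * h) (hmult : ∀ w ∈ U, ∃ u : ℕ, w * α = α ^ u * w)
    {w : G} (hw : w ∈ U) {u₀ : ℕ} (hrel : w * α = α ^ u₀ * w) (hw1 : w * α ≠ α * w)
    (hw2 : w * α * w⁻¹ ≠ α⁻¹) :
    ∃ u₁ : ℕ, (u₀ : ZMod (2 * h)) * u₁ = 1 ∧ (u₀ : ZMod (2 * h)) ≠ 1 ∧ (u₀ : ZMod (2 * h)) ≠ -1 := by
  haveI : NeZero (2 * h) := ⟨by have := NeZero.ne h; omega⟩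
  haveI : Fact (1 < 2 * h) := ⟨by have := NeZero.ne h; omega⟩
  obtain ⟨u₁, hrel'⟩ := hmult w⁻¹ (U.inv_mem hw)
  refine ⟨u₁, mul_eq_one_of_mult hord hrel hrel', fun h1 => hw1 ?_, fun h1 => hw2 ?_⟩
  · rw [hrel, pow_eq_pow_val_natCast hord u₀, h1, ZMod.val_one, pow_one]
  · rw [hrel, mul_inv_cancel_right, pow_eq_pow_val_natCast hord u₀, h1]
    have hmul1 : α ^ (-1 : ZMod (2 * h)).val * α ^ (1 : ZMod (2 * h)).val = 1 := by
      rw [← pow_val_add hord, neg_add_cancel, ZMod.val_zero, pow_zero]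
    rw [ZMod.val_one, pow_one] at hmul1
    exact eq_inv_of_mul_eq_one_left hmul1

/-- **TRIVIAL LEFT STABILISER** when `U` acts on `⟨α⟩` by multipliers other than `±1`: every `w ∈ U` has
`w α = α^{u} w` for some `u`, with `u = 1` only for `w = 1` and never `w α w⁻¹ = α⁻¹`.  Then no `v ≠ 1` satisfies
`v T = T` (`h ≥ 2`). [cite: Shimura1998, §8.2 Prop. 26] -/
theorem cosetInterval_leftStabiliser [Fintype G] (h2 : 2 ≤ h) (hord : orderOf α = 2 * h)
    (hAU : ∀ w ∈ U, w ∈ Subgroup.zpowers α → w = 1) (hcard : Fintype.card G = 2 * h * Nat.card U)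
    (hmult : ∀ w ∈ U, ∃ u : ℕ, w * α = α ^ u * w) (hfaith : ∀ w ∈ U, w * α = α * w → w = 1)
    (hninv : ∀ w ∈ U, w * α * w⁻¹ ≠ α⁻¹)
    (hT : ∀ x : ZMod (2 * h), ∀ w ∈ U, α ^ x.val * w ∈ T ↔ x.val < h) (v : G) (hv : v ≠ 1) :
    ∃ w : G, ¬ (w ∈ T ↔ v * w ∈ T) := by
  haveI : NeZero h := ⟨by omega⟩
  haveI : NeZero (2 * h) := ⟨by omega⟩
  have hT1 : ∀ x : ZMod (2 * h), α ^ x.val ∈ T ↔ x.val < h := fun x => by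
    have := hT x 1 U.one_mem; rwa [mul_one] at this
  obtain ⟨j, w, hw, rfl⟩ := exists_normalForm_sub hord hAU hcard v
  by_cases hw1 : w = 1
  · -- `v = α^j`, `j ≠ 0`
    subst hw1
    rw [mul_one] at hv ⊢
    have hj : j.val ≠ 0 := fun h0 => hv (by rw [h0, pow_zero])
    have hjlt := j.val_lt
    by_cases hjh : j.val < h
    · refine ⟨α ^ ((((h : ℕ) : ZMod (2 * h)) - j)).val, fun hiff => ?_⟩
      rw [← pow_val_add hord, add_sub_cancel, hT1, hT1, val_natCast_sub_eq j (show h < 2 * h by omega),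
        val_natCast_of_lt' (show h < 2 * h by omega)] at hiff
      split_ifs at hiff <;> omega
    · refine ⟨α ^ ((0 : ZMod (2 * h))).val, fun hiff => ?_⟩
      rw [← pow_val_add hord, add_zero, hT1, hT1, ZMod.val_zero] at hiff
      omega
  · -- `v = α^j w`, `w ≠ 1`: the multiplier `u` of `w` is a unit `≠ ±1`
    obtain ⟨u₀, hrel⟩ := hmult w hw
    obtain ⟨u₁, hu, hu1, hu2⟩ := multiplier_unit_ne hord hmult hw hrel (fun h1 => hw1 (hfaith w hw h1)) (hninv w hw)
    by_contra hall
    push Not at hall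
    refine not_affine_preserves_interval h2 (j := j) hu hu1 hu2 fun i => ?_
    have := hall (α ^ i.val)
    rwa [show (α ^ j.val * w) * α ^ i.val = α ^ (j + (u₀ : ZMod (2 * h)) * i).val * w by
      have := mult_mul_normalForm hord hrel j i 1
      rwa [mul_one, mul_one] at this, hT1, hT _ w hw] at this

/-- **The only central involution is `α^h`** (`U` acting faithfully by multipliers): a central `αˣ w` commutes with
`α`, so `u_w = 1` and `w = 1`; an involution `αˣ ≠ 1` has `x = h`. [cite: Shimura1998, §18.2 Lemma (i)] -/
theorem central_involution_eq_pow_sub [Fintype G] (h2 : 2 ≤ h) (hord : orderOf α = 2 * h)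
    (hAU : ∀ w ∈ U, w ∈ Subgroup.zpowers α → w = 1) (hcard : Fintype.card G = 2 * h * Nat.card U)
    (hmult : ∀ w ∈ U, ∃ u : ℕ, w * α = α ^ u * w) (hfaith : ∀ w ∈ U, w * α = α * w → w = 1) (c : G)
    (hc1 : c * c = 1) (hc2 : c ≠ 1) (hcomm : ∀ y : G, c * y = y * c) : c = α ^ h := by
  haveI : NeZero h := ⟨by omega⟩
  haveI : NeZero (2 * h) := ⟨by omega⟩
  haveI : Fact (1 < 2 * h) := ⟨by omega⟩
  obtain ⟨x, w, hw, rfl⟩ := exists_normalForm_sub hord hAU hcard c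
  obtain ⟨u₀, hrel⟩ := hmult w hw
  -- `w = 1`
  have hw1 : w = 1 := by
    apply hfaith w hw
    have h1 := hcomm (α ^ (1 : ZMod (2 * h)).val)
    have lhs : α ^ x.val * w * α ^ (1 : ZMod (2 * h)).val = α ^ (x + (u₀ : ZMod (2 * h))).val * w := by
      have := mult_mul_normalForm hord hrel x (1 : ZMod (2 * h)) 1
      simp only [mul_one] at this
      exact this
    have rhs : α ^ (1 : ZMod (2 * h)).val * (α ^ x.val * w) = α ^ ((1 : ZMod (2 * h)) + x).val * w := by
      rw [← mul_assoc, ← pow_val_add hord]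
    rw [lhs, rhs] at h1
    have hx := (normalForm_sub_inj hord hAU hw hw h1).1
    rw [add_comm] at hx
    have hu1 : (u₀ : ZMod (2 * h)) = 1 := add_right_cancel hx
    rw [hrel, pow_eq_pow_val_natCast hord u₀, hu1, ZMod.val_one, pow_one]
  subst hw1
  rw [mul_one] at hc1 hc2 ⊢
  have hxx : x + x = 0 := by
    have h1 : α ^ (x + x).val = α ^ (0 : ZMod (2 * h)).val := by
      rw [pow_val_add hord, hc1, ZMod.val_zero, pow_zero]
    exact (pow_val_inj hord).1 h1
  have hx0 : x.val ≠ 0 := fun h0 => hc2 (by rw [h0, pow_zero])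
  have hlt := x.val_lt
  have hcast : ((x.val + x.val : ℕ) : ZMod (2 * h)) = 0 := by
    rw [Nat.cast_add, ZMod.natCast_zmod_val, hxx]
  rw [ZMod.natCast_eq_zero_iff] at hcast
  obtain ⟨q, hq⟩ := hcast
  have hq1 : q = 1 := by
    rcases Nat.lt_or_ge q 2 with hq2 | hq2
    · interval_cases q <;> omega
    · have h4 : 2 * h * 2 ≤ 2 * h * q := Nat.mul_le_mul_left _ hq2
      generalize 2 * h * q = N at hq h4
      omega
  rw [hq1, mul_one] at hq
  rw [show x.val = h by omega]

end Group

end Literature.NumberTheory.ComplexMultiplication.GaloisCosetInterval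

end
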